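import Mathlib
import Literature.Combinatorics.Additive.GrynkiewiczPollardExtension
import Literature.Combinatorics.Additive.GrynkiewiczPollardExtensionProof
import Summits.MatrixMultiplication.MatrixMultiplication.Theses.AbelianSTPPCensusVP

/-!
# Route `AbelianSTPPCensusVP`, crux `GrynkiewiczWeak` (stmt-MatrixMultiplication-19190) — closed

Cell mm-stpp (rung F-M1.T_E/337).  The crux is the conjunction of the WEAK forms of Grynkiewicz 2010
Theorem 1.1 (`t ≥ 3`) and Theorem 1.2 (`t = 2`); the printed theorems are now KERNEL THEOREMS
(`Literature.Combinatorics.Additive.grynkiewicz2010_thm_1_1_holds` / `_1_2_holds`, the ten-file port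
`GrynkiewiczPollard*.lean`), and `GrynkiewiczPollardExtension.lean` derives the weak forms from them.  The only
glue is `Theorems.Nt X Y t = Σ_{x ∈ X+Y} min(t, Pollard.rep X Y x)` (the tree's `repCount` is syntactically
`Pollard.rep`; representation counts vanish off `X + Y`) — this is the planner's registered skeleton
`GrynkiewiczWeak_birth.lean` (gen 7) with its two stubs replaced by the `_holds` theorems.

WHAT THIS IS NOT: no `ω` statement; the other crux `ShapeExclusionVP337` (the vP certificate replay to 337) is
untouched.
-/

set_option linter.dupNamespace false -- `MatrixMultiplication.MatrixMultiplication` (summit = problem, D-0017)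

namespace Summit.MatrixMultiplication.MatrixMultiplication.Theorems

namespace GrynkiewiczWeakClose

open Finset Literature.Combinatorics.Additive
open scoped Pointwise

variable {G : Type*} [AddCommGroup G] [DecidableEq G]

/-- The tree's `repCount` is Pollard's representation function. [bookkeeping] -/
theorem repCount_eq_rep (X Y : Finset G) (w : G) : repCount X Y w = Pollard.rep X Y w := rfl

/-- `N_t(X,Y)` (tree: a sum over the whole finite group) equals the sum over the sumset used in the
Literature statement. [bookkeeping] -/
theorem Nt_eq_sum_sumset [Fintype G] (X Y : Finset G) (t : ℕ) :
    Nt X Y t = ∑ x ∈ X + Y, min t (Pollard.rep X Y x) := by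
  unfold Nt
  symm
  refine sum_subset (subset_univ (X + Y)) ?_
  intro w _ hw
  simp [Grynkiewicz.rep_eq_zero_of_not_mem hw]

end GrynkiewiczWeakClose

open Finset Literature.Combinatorics.Additive GrynkiewiczWeakClose in
/-- **Crux `GrynkiewiczWeak` of route `AbelianSTPPCensusVP`** (stmt-MatrixMultiplication-19190): for every
finite abelian group `G`, `X, Y ⊆ G`, `t ≥ 2` with `|X|, |Y| ≥ t`, either the Pollard-type floor
(`t(|X|+|Y|) + 1 ≤ N_t + 2t²` for `t ≥ 3`, `2(|X|+|Y|) ≤ N_2 + 4` for `t = 2`) holds, or at most `t − 1`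
elements can be deleted from `X, Y` so that every remaining sum is `t`-popular in `X + Y` — from the kernel
theorems `grynkiewicz2010_thm_1_1_holds` / `grynkiewicz2010_thm_1_2_holds` ([Gry10] Thm 1.1 / 1.2 as printed).
[original] -/
theorem GrynkiewiczWeak_proof :
    Summit.MatrixMultiplication.MatrixMultiplication.Theses.AbelianSTPPCensusVP.GrynkiewiczWeak := by
  intro G _ _ _ X Y t ht htX htY
  by_cases h3 : 3 ≤ t
  · rcases grynkiewicz2010_thm_1_1_weak grynkiewicz2010_thm_1_1_holds G X Y t (by omega) htX htY with
      h6 | ⟨X', hX', Y', hY', h7, h8⟩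
    · refine Or.inl ⟨fun _ => ?_, fun h => by omega⟩
      rw [Nt_eq_sum_sumset, mul_add]
      exact h6
    · refine Or.inr ⟨X', hX', Y', hY', h7, fun x hx y hy => ?_⟩
      rw [repCount_eq_rep]
      exact h8 (x + y) (add_mem_add hx hy)
  · have ht2 : t = 2 := by omega
    subst ht2
    rcases grynkiewicz2010_thm_1_2_weak grynkiewicz2010_thm_1_2_holds G X Y htX htY with
      h10 | ⟨X', hX', Y', hY', h11, h12⟩
    · refine Or.inl ⟨fun h => by omega, fun _ => ?_⟩
      rw [Nt_eq_sum_sumset, mul_add]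
      exact h10
    · refine Or.inr ⟨X', hX', Y', hY', by omega, fun x hx y hy => ?_⟩
      rw [repCount_eq_rep]
      exact h12 (x + y) (add_mem_add hx hy)

/-- The support item `U11GSound` of the route's earlier cut (rule U11-G for every STPP family in a finite
abelian group) is now UNCONDITIONAL: the fibre lemma file's `STPPRepCount.u11GSound_of_grynkiewiczWeak`
applied to `GrynkiewiczWeak_proof`. [original] -/
theorem u11GSound_holds :
    ∀ (H : Type) [AddCommGroup H] [Fintype H] (N : ℕ) (A B C : Fin N → Finset H),
      Literature.Computability.AlgebraicComplexity.IsSTPP A B C →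
      (∀ i, (A i).Nonempty ∧ (B i).Nonempty ∧ (C i).Nonempty) →
        U11G (Fintype.card H) (fun i => (A i).card) (fun i => (B i).card) (fun i => (C i).card) :=
  STPPRepCount.u11GSound_of_grynkiewiczWeak GrynkiewiczWeak_proof

end Summit.MatrixMultiplication.MatrixMultiplication.Theorems
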